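import Mathlib.LinearAlgebra.Isomorphisms
import Mathlib.LinearAlgebra.Span.Basic
import HarnessLib

/-!
# Route `SignedLowerHalves`, crux L `SmallImageLowerHalfBothSigns` (stmt-BirchSwinnertonDyer-23599), line `rtt_w3` v13 — E2, LEAD:
# QUASI-ISOMORPHISMS DESCEND TO QUOTIENTS BY A CYCLIC SUBMODULE (finite kernel and cokernel are kept)

WHY (BRIEF-E2 rev 3 §3; LEAD ruling (R1) on the bus, 2026-08-30). The glue in localisation form `charRoad_E2_of_localisation` (p776213) takes its global
input as `hK : λ(ker gX ⧸ Λ_𝒪∙z) ≤ λ(coker gX)`, while the D2 definer (-w3 g19, `SmallImageRttD2Spec.*`) proves the inequality for the θ-specialised JLK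
carriers `(Hsp ⧸ ∙zsp, Ysp)`; row D2-seq identifies `Hsp ↔ ker gX`, `Ysp ↔ coker gX` by maps with FINITE kernel and cokernel (Poitou–Tate / class field
theory on the θ-line), and `λ` is transported by `lambdaInvariant_eq_of_finite_ker_coker` (p776013). This file supplies the missing step: for an `R`-linear
`e : A → B` with finite kernel and cokernel and `z ∈ A`, the induced map `A ⧸ R∙z → B ⧸ R∙e(z)` again has finite kernel and finite cokernel
(`finite_ker_mapQ_span_singleton`, `finite_quotient_range_mapQ_span_singleton`; any ring `R`). THEOREMS ONLY (module algebra); nothing about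
`BirchSwinnertonDyer`, crux L or E2 is proved here. [folklore]
-/

set_option linter.dupNamespace false -- D-0017: single-problem summit, the namespace repeats the problem name by design
set_option autoImplicit false

noncomputable section

namespace Summit.BirchSwinnertonDyer.BirchSwinnertonDyer.Theorems.SmallImageRttCharRoad

universe u v w

variable {R : Type u} [Ring R] {A : Type v} {B : Type w} [AddCommGroup A] [Module R A] [AddCommGroup B] [Module R B]

/-- `R∙z ≤ e⁻¹(R∙e z)`: the hypothesis of `Submodule.mapQ` for the induced map `A ⧸ R∙z → B ⧸ R∙e z`. [folklore] -/
theorem span_singleton_le_comap_span_singleton (e : A →ₗ[R] B) (z : A) :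
    (R ∙ z) ≤ (R ∙ e z).comap e := by
  rw [Submodule.span_singleton_le_iff_mem, Submodule.mem_comap]
  exact Submodule.mem_span_singleton_self (e z)

/-- **Finite kernel descends**: if `e : A → B` is `R`-linear with finite kernel, then the induced map `A ⧸ R∙z → B ⧸ R∙e(z)` has finite kernel —
it is the image of `ker e` (`x` with `e x = r • e z` satisfies `x − r • z ∈ ker e`). [folklore] -/
theorem finite_ker_mapQ_span_singleton (e : A →ₗ[R] B) (z : A) (hker : Finite (LinearMap.ker e)) :
    Finite (LinearMap.ker ((R ∙ z).mapQ (R ∙ e z) e (span_singleton_le_comap_span_singleton e z))) := by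
  -- every kernel element is the class of a kernel element of `e`
  have hsurj : ∀ x : LinearMap.ker ((R ∙ z).mapQ (R ∙ e z) e (span_singleton_le_comap_span_singleton e z)),
      ∃ k : LinearMap.ker e, (R ∙ z).mkQ (k : A) = (x : A ⧸ (R ∙ z)) := by
    rintro ⟨x, hx⟩
    obtain ⟨a, rfl⟩ := Submodule.mkQ_surjective (R ∙ z) x
    rw [LinearMap.mem_ker, Submodule.mkQ_apply, Submodule.mapQ_apply, Submodule.Quotient.mk_eq_zero,
      Submodule.mem_span_singleton] at hx
    obtain ⟨r, hr⟩ := hx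
    refine ⟨⟨a - r • z, ?_⟩, ?_⟩
    · rw [LinearMap.mem_ker, map_sub, map_smul, hr, sub_self]
    · change (R ∙ z).mkQ (a - r • z) = (R ∙ z).mkQ a
      rw [map_sub, map_smul, Submodule.mkQ_apply, Submodule.mkQ_apply,
        (Submodule.Quotient.mk_eq_zero (R ∙ z)).mpr (Submodule.mem_span_singleton_self z), smul_zero, sub_zero]
  choose k hk using hsurj
  refine Finite.of_injective k fun x y h ↦ Subtype.ext ?_
  rw [← hk x, ← hk y, h]

/-- **Finite cokernel descends**: if `e : A → B` is `R`-linear with finite cokernel, then the induced map `A ⧸ R∙z → B ⧸ R∙e(z)` has finite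
cokernel — `(B ⧸ R∙e z) ⧸ image ≅ B ⧸ (R∙e z ⊔ e(A))`, a quotient of `B ⧸ e(A)`. [folklore] -/
theorem finite_quotient_range_mapQ_span_singleton (e : A →ₗ[R] B) (z : A) (hcoker : Finite (B ⧸ LinearMap.range e)) :
    Finite ((B ⧸ (R ∙ e z)) ⧸ LinearMap.range ((R ∙ z).mapQ (R ∙ e z) e (span_singleton_le_comap_span_singleton e z))) := by
  rw [Submodule.range_mapQ]
  have hle : LinearMap.range e ≤ ((R ∙ e z) ⊔ LinearMap.range e).comap (LinearMap.id : B →ₗ[R] B) := by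
    rw [Submodule.comap_id]
    exact le_sup_right
  haveI : Finite (B ⧸ ((R ∙ e z) ⊔ LinearMap.range e)) :=
    Finite.of_surjective ((LinearMap.range e).mapQ ((R ∙ e z) ⊔ LinearMap.range e) LinearMap.id hle) fun x ↦ by
      obtain ⟨b, rfl⟩ := Submodule.mkQ_surjective _ x
      exact ⟨Submodule.mkQ _ b, by rw [Submodule.mkQ_apply, Submodule.mapQ_apply]; rfl⟩
  exact Finite.of_equiv _ (Submodule.quotientQuotientEquivQuotientSup (R ∙ e z) (LinearMap.range e)).toEquiv.symm

end Summit.BirchSwinnertonDyer.BirchSwinnertonDyer.Theorems.SmallImageRttCharRoad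

end
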